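import Summits.ResolutionOfSingularities.ResolutionOfSingularities.Theorems.PurelyInseparableDim4ResConeCInfVirtualEntryRotation
import Summits.ResolutionOfSingularities.ResolutionOfSingularities.Theorems.PurelyInseparableDim4ResConeCInfAssembly
import Summits.ResolutionOfSingularities.ResolutionOfSingularities.Theorems.PurelyInseparableDim4IsolationConverse
import HarnessLib
import HarnessLib.Audit.Tags

/-!
# Purely inseparable four-folds — THE C∞ VIRTUAL ENTRY AT A LATE TIME OF THE CHAIN (K24b-R1 (E0) packaging, part 1):
# letters, power cone, K11-lin ledger and the step kind read off the chain binders
# (cell `res-dim4-pi`, K2(p) lane, slice B; hN4 discharge)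

[OURS · counted 0 · cell `res-dim4-pi` · K2(p) lane; the K2(p) lane holder's word (bus 2026-08-29 06:20:38Z «p-3 files K27e»)
and crit-4 g5's §K-A4-123 («what hE still needs is the OUTER packaging from the chain»); seat res-dim4-p-3 g4.]  Nothing here
proves K2(p)/K2(5), `NoIsolatedTrap 5 5` or resolution of singularities in dimension ≥ 4 / characteristic `p` — NOT proved.
AI kernel work, weaker than expert review.

* `cInf_inner_symm` — the entry block (res-dim4-typ-1 g3's `hE` inner block: `ℛ²`-relation along `π₀` + frame at jet `N`)
  is symmetric in the two slot names `λ ↔ μ`.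
* **`cInf_entry_at`** — along a witnessed isolated `Step0 5` chain in the C∞ regime (shade `≡ 4`, `e_G ≡ 3`, weights `≤ 1`
  of total `2` from `k₀`, slots born from `k₁`), at every time `k′ ≥ k₁`, `k′ ≥ 1`: four letters `λ μ u f`, a bijection
  `π₀` with `(c (k′+1)).r = e_{π₀λ} + e_{π₀μ}`, and for all `M N` a framed virtual state `B₀` related to `c (k′+1)` —
  the `hE` block at `k = k′ + 1`.  ROUTE: slots `λ, μ` of `c k′` (`exists_pair_letters`), their births (`hborn`), the
  contact letter `f` with `ℓ_{k′} f ≠ 0` (`contactSupport_not_subset_pair` on `chain_powerCone_package`), the fourth letter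
  `u`, the K11-lin ledger (`stretch_pair_ledger_linear`), order `6` (`chain_shade_nat`), cleanliness
  (`deletePthPowers_step_F`); then `SwapTransport.step_cases_of_weights` on the step `k′`: a SLOT step feeds
  `exists_cInf_virtual_entry_rel` (`π₀ = 1`), a ROTATION feeds `exists_cInf_virtual_entry_of_rotation` (`π₀ = (κ g)`,
  certificate level by `IsolationConverse.exists_certificate_of_isIsolated`).

[cite: CossartJannsenSaito2020, Thm. 3.14, Lemma 13.2] [cite: Hauser2010, §§F–G]
bears_on: LADDER-RESOLUTION:D157-DOOR2 (res-dim4-pi · K2(p) slice B · hN4 packaging, part 1).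
Supports stmt-ResolutionOfSingularities-16155 (helper).
-/

set_option linter.dupNamespace false -- mandated namespace of this single-conjunct summit

noncomputable section

namespace Summit.ResolutionOfSingularities.ResolutionOfSingularities.Theorems.PIDim4

namespace ResCone

open MvPolynomial Finset
open Literature.AlgebraicGeometry.Resolution
open Literature.AlgebraicGeometry.Resolution.CentreBlowup
open Literature.AlgebraicGeometry.Resolution.Hauser2010
open Literature.AlgebraicGeometry.Resolution.HauserPerlega2019

variable {K : Type} [Field K] [CharP K 5] [DecidableEq K]

omit [CharP K 5] [DecidableEq K] in
/-- The entry block is symmetric in the two slot names. [OURS · bookkeeping] -/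
theorem cInf_inner_symm {la mu u f : Fin 4} {π₀ : Equiv.Perm (Fin 4)} {F : MvPolynomial (Fin 4) K} {M N : ℕ}
    (h : ∃ B₀ : State K,
      (∃ (θ e : Fin 4 → MvPolynomial (Fin 4) K) (U E : MvPolynomial (Fin 4) K),
        θ (π₀ la) = X la * e la ∧ θ (π₀ mu) = X mu * e mu ∧ constantCoeff (e la) ≠ 0 ∧ constantCoeff (e mu) ≠ 0 ∧
        constantCoeff (θ (π₀ u)) = 0 ∧ constantCoeff (θ (π₀ f)) = 0 ∧
        coeff (Finsupp.single u 1) (θ (π₀ u)) * coeff (Finsupp.single f 1) (θ (π₀ f)) -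
          coeff (Finsupp.single f 1) (θ (π₀ u)) * coeff (Finsupp.single u 1) (θ (π₀ f)) ≠ 0 ∧
        constantCoeff U ≠ 0 ∧ E ∈ originIdeal K ^ M ∧ B₀.F = deletePthPowers 5 (U ^ 5 * aeval θ F) + E) ∧
      ordZero B₀.F = 6 ∧ B₀.r = Finsupp.single la 1 + Finsupp.single mu 1 ∧ (∀ d ∈ B₀.F.support, B₀.r ≤ d) ∧
      (∃ a : K, a ≠ 0 ∧ resForm B₀ = C a * X f ^ 4) ∧
      (∀ e ∈ B₀.F.support, e f ≤ 3 → 2 ≤ e la ∧ 2 ≤ e mu) ∧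
      (∀ d ∈ B₀.F.support, d.degree < N → ¬ (d u = 2 ∧ d f = 0)) ∧
      coeff (B₀.r + (Finsupp.single la 1 + Finsupp.single mu 1 + Finsupp.single u 3)) B₀.F ≠ 0 ∧
      IsIsolated 5 B₀.F ∧ Module.finrank K (resVertex B₀) = 3) :
    ∃ B₀ : State K,
      (∃ (θ e : Fin 4 → MvPolynomial (Fin 4) K) (U E : MvPolynomial (Fin 4) K),
        θ (π₀ mu) = X mu * e mu ∧ θ (π₀ la) = X la * e la ∧ constantCoeff (e mu) ≠ 0 ∧ constantCoeff (e la) ≠ 0 ∧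
        constantCoeff (θ (π₀ u)) = 0 ∧ constantCoeff (θ (π₀ f)) = 0 ∧
        coeff (Finsupp.single u 1) (θ (π₀ u)) * coeff (Finsupp.single f 1) (θ (π₀ f)) -
          coeff (Finsupp.single f 1) (θ (π₀ u)) * coeff (Finsupp.single u 1) (θ (π₀ f)) ≠ 0 ∧
        constantCoeff U ≠ 0 ∧ E ∈ originIdeal K ^ M ∧ B₀.F = deletePthPowers 5 (U ^ 5 * aeval θ F) + E) ∧
      ordZero B₀.F = 6 ∧ B₀.r = Finsupp.single mu 1 + Finsupp.single la 1 ∧ (∀ d ∈ B₀.F.support, B₀.r ≤ d) ∧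
      (∃ a : K, a ≠ 0 ∧ resForm B₀ = C a * X f ^ 4) ∧
      (∀ e ∈ B₀.F.support, e f ≤ 3 → 2 ≤ e mu ∧ 2 ≤ e la) ∧
      (∀ d ∈ B₀.F.support, d.degree < N → ¬ (d u = 2 ∧ d f = 0)) ∧
      coeff (B₀.r + (Finsupp.single mu 1 + Finsupp.single la 1 + Finsupp.single u 3)) B₀.F ≠ 0 ∧
      IsIsolated 5 B₀.F ∧ Module.finrank K (resVertex B₀) = 3 := by
  obtain ⟨B₀, ⟨θ, e, U, E, h1, h2, h3, h4, h5, h6, h7, h8, h9, h10⟩, ho, hr, hdiv, hres, hled, hrow, hV, hiso, he3⟩ := h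
  refine ⟨B₀, ⟨θ, e, U, E, h2, h1, h4, h3, h5, h6, h7, h8, h9, h10⟩, ho, by rw [hr, add_comm], hdiv, hres,
    fun d hd hdf => (hled d hd hdf).symm, hrow, ?_, hiso, he3⟩
  rw [show Finsupp.single mu 1 + Finsupp.single la 1 + Finsupp.single u 3 =
    (Finsupp.single la 1 + Finsupp.single mu 1 + Finsupp.single u 3 : Fin 4 →₀ ℕ) by rw [add_comm (Finsupp.single mu 1)]]
  exact hV

/-- **THE C∞ VIRTUAL ENTRY AT A LATE TIME OF THE CHAIN** (statement and route in the module docstring). [OURS]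
[cite: CossartJannsenSaito2020, Thm. 3.14, Lemma 13.2] [cite: Hauser2010, §§F–G] -/
theorem cInf_entry_at {c : ℕ → State K} {j : ℕ → Fin 4} {b : ℕ → Fin 4 → K}
    (hc : ∀ k, IsIsolated 5 (c k).F ∧ Step0 5 (c k) (c (k + 1))) (hw : FreeTail.IsWitnessedChain 5 c j b)
    (hr0 : ∀ e ∈ (c 0).F.support, (c 0).r ≤ e) (hfloor : ∀ k, ordZero (c k).F ≠ (5 : ℕ)) {k₀ : ℕ}
    (hshade : ∀ k, k₀ ≤ k → (c k).shade = ((4 : ℕ) : ℕ∞))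
    (he3 : ∀ k, k₀ ≤ k → Module.finrank K (resVertex (c k)) = 3) {k₁ : ℕ} (hk₁ : k₀ ≤ k₁)
    (hwt : ∀ k, k₀ ≤ k → (∀ i, (c k).r i ≤ 1) ∧ (c k).r.degree = 2)
    (hborn : ∀ k, k₁ ≤ k → ∀ i, 1 ≤ (c k).r i →
      ∃ t, k₀ ≤ t ∧ t < k ∧ j t = i ∧ ∀ m, t < m → m < k → j m ≠ i ∧ b m i = 0)
    {k' : ℕ} (hk' : k₁ ≤ k') (hk'1 : 1 ≤ k') :
    ∃ (la mu u f : Fin 4) (π₀ : Equiv.Perm (Fin 4)), la ≠ mu ∧ la ≠ u ∧ la ≠ f ∧ mu ≠ u ∧ mu ≠ f ∧ u ≠ f ∧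
      (c (k' + 1)).r = Finsupp.single (π₀ la) 1 + Finsupp.single (π₀ mu) 1 ∧
      ∀ M N : ℕ, ∃ B₀ : State K,
        (∃ (θ e : Fin 4 → MvPolynomial (Fin 4) K) (U E : MvPolynomial (Fin 4) K),
          θ (π₀ la) = X la * e la ∧ θ (π₀ mu) = X mu * e mu ∧ constantCoeff (e la) ≠ 0 ∧ constantCoeff (e mu) ≠ 0 ∧
          constantCoeff (θ (π₀ u)) = 0 ∧ constantCoeff (θ (π₀ f)) = 0 ∧
          coeff (Finsupp.single u 1) (θ (π₀ u)) * coeff (Finsupp.single f 1) (θ (π₀ f)) -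
            coeff (Finsupp.single f 1) (θ (π₀ u)) * coeff (Finsupp.single u 1) (θ (π₀ f)) ≠ 0 ∧
          constantCoeff U ≠ 0 ∧ E ∈ originIdeal K ^ M ∧ B₀.F = deletePthPowers 5 (U ^ 5 * aeval θ (c (k' + 1)).F) + E) ∧
        ordZero B₀.F = 6 ∧ B₀.r = Finsupp.single la 1 + Finsupp.single mu 1 ∧ (∀ d ∈ B₀.F.support, B₀.r ≤ d) ∧
        (∃ a : K, a ≠ 0 ∧ resForm B₀ = C a * X f ^ 4) ∧
        (∀ e ∈ B₀.F.support, e f ≤ 3 → 2 ≤ e la ∧ 2 ≤ e mu) ∧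
        (∀ d ∈ B₀.F.support, d.degree < N → ¬ (d u = 2 ∧ d f = 0)) ∧
        coeff (B₀.r + (Finsupp.single la 1 + Finsupp.single mu 1 + Finsupp.single u 3)) B₀.F ≠ 0 ∧
        IsIsolated 5 B₀.F ∧ Module.finrank K (resVertex B₀) = 3 := by
  haveI : Fact (Nat.Prime 5) := ⟨by norm_num⟩
  have hiso : ∀ k, IsIsolated 5 (c k).F := fun k => (hc k).1
  have hbj : ∀ k, b k (j k) = 0 := fun k => (hw k).2.1
  have hstep : ∀ k, c (k + 1) = CentreBlowup.step 5 Finset.univ (j k) (b k) (c k) := fun k => (hw k).2.2.2.2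
  have hdivk : ∀ k, ∀ e ∈ (c k).F.support, (c k).r ≤ e := IsolatedBand.isolated_chain_forall_le hc hr0
  have ho6 : ∀ k, k₀ ≤ k → ordZero (c k).F = ((6 : ℕ) : ℕ∞) := fun k hk => by
    obtain ⟨o, ho, hpo, -, hod⟩ := chain_shade_nat 5 hc hfloor hshade hk
    rw [(hwt k hk).2] at hod
    rw [ho]; congr 1; omega
  have ho6' : ∀ k, k₀ ≤ k → ordZero (c k).F = 6 := fun k hk => by rw [ho6 k hk]; rfl
  have hk'₀ : k₀ ≤ k' := hk₁.trans hk'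
  have hk'₀1 : k₀ ≤ k' + 1 := by omega
  -- (1) the slots of `c k′`, the power-cone package, the births, the contact letter `f`, the fourth letter `u`
  obtain ⟨la, mu, hlm, hrk'⟩ := exists_pair_letters (hwt k' hk'₀).1 (hwt k' hk'₀).2
  obtain ⟨ℓ, a0, lam, hpkg⟩ := chain_powerCone_package 5 hc hw hr0 hfloor (by norm_num) hshade he3
  have hform : ∀ k, k₀ ≤ k → resForm (c k) = C (a0 k) * (∑ i, C (ℓ k i) * X i) ^ 4 := fun k hk => (hpkg k hk).2.2.1
  have hdir : ∀ k, k₀ ≤ k → ℓ k (j k) + dotProduct (ℓ k) (b k) = 0 := fun k hk => (hpkg k hk).2.2.2.1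
  have hlam : ∀ k, k₀ ≤ k → lam k ≠ 0 := fun k hk => (hpkg k hk).2.2.2.2.1
  have hprop : ∀ k, k₀ ≤ k → ∀ i, i ≠ j k → ℓ (k + 1) i = lam k * ℓ k i := fun k hk => (hpkg k hk).2.2.2.2.2.1
  have hcarry : ∀ k, k₀ ≤ k → ∃ i, i ≠ j k ∧ ℓ k i ≠ 0 := fun k hk => (hpkg k hk).2.2.2.2.2.2
  obtain ⟨ta, hta, htak, hja, hkepta⟩ := hborn k' hk' la (Nat.one_le_iff_ne_zero.mpr (by
    rw [hrk', Finsupp.add_apply, Finsupp.single_eq_same, Finsupp.single_eq_of_ne hlm]; omega))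
  obtain ⟨tb, htb, htbk, hjb, hkeptb⟩ := hborn k' hk' mu (Nat.one_le_iff_ne_zero.mpr (by
    rw [hrk', Finsupp.add_apply, Finsupp.single_eq_of_ne (Ne.symm hlm), Finsupp.single_eq_same]; omega))
  have hf : ∃ f : Fin 4, f ≠ la ∧ f ≠ mu ∧ ℓ k' f ≠ 0 := by
    rcases Nat.lt_or_gt_of_ne (show ta ≠ tb from fun h => hlm (by rw [← hja, ← hjb, h])) with hlt | hlt
    · obtain ⟨m, h1, h2, h3⟩ := contactSupport_not_subset_pair hdir hlam hprop hcarry hbj hta hlt htbk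
        (fun m hm hmk => by rw [hja]; exact hkepta m hm hmk) (fun m hm hmk => by rw [hjb]; exact hkeptb m hm hmk)
      exact ⟨m, by rw [← hja]; exact h1, by rw [← hjb]; exact h2, h3⟩
    · obtain ⟨m, h1, h2, h3⟩ := contactSupport_not_subset_pair hdir hlam hprop hcarry hbj htb hlt htak
        (fun m hm hmk => by rw [hjb]; exact hkeptb m hm hmk) (fun m hm hmk => by rw [hja]; exact hkepta m hm hmk)
      exact ⟨m, by rw [← hja]; exact h2, by rw [← hjb]; exact h1, h3⟩
  obtain ⟨f, hfl, hfm, hℓf⟩ := hf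
  obtain ⟨u, hul, hum, huf, -⟩ := exists_fourth_letter hlm hfl.symm hfm.symm
  -- (2) the K11-lin ledger, cleanliness, the child's weights
  obtain ⟨U, S, T, hU, hledger⟩ := stretch_pair_ledger_linear 5 hc hw hr0 hfloor (by norm_num : 1 ≤ 4) hshade hform
    hdir hlam hprop hcarry hlm hfl hfm hℓf hta htak hja hkepta htb htbk hjb hkeptb
  have hclean : deletePthPowers 5 (c k').F = (c k').F := by
    obtain ⟨k'', rfl⟩ : ∃ k'', k' = k'' + 1 := ⟨k' - 1, by omega⟩
    rw [hstep k'']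
    exact FrameChange.deletePthPowers_step_F 5 Finset.univ (j k'') (b k'') (c k'')
  have hw1 : ∀ i, (CentreBlowup.step 5 Finset.univ (j k') (b k') (c k')).r i ≤ 1 := by
    rw [← hstep k']; exact (hwt (k' + 1) hk'₀1).1
  have hdeg : (CentreBlowup.step 5 Finset.univ (j k') (b k') (c k')).r.degree = 2 := by
    rw [← hstep k']; exact (hwt (k' + 1) hk'₀1).2
  -- (3) the step kind
  rcases SwapTransport.step_cases_of_weights hlm hul.symm hfl.symm hum.symm hfm.symm huf hrk' (ho6' k' hk'₀) hw1 hdeg with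
    ⟨hjla, hbmu, hr'⟩ | ⟨hjmu, hbla, hr'⟩ | ⟨hjuf, ⟨hbla, hbmu, hr'⟩ | ⟨hbmu, hbla, hr'⟩⟩
  · -- SLOT step in the chart `λ`
    have hbla : b k' la = 0 := by rw [← hjla]; exact hbj k'
    refine ⟨la, mu, u, f, 1, hlm, hul.symm, hfl.symm, hum.symm, hfm.symm, huf, ?_, fun M N => ?_⟩
    · rw [Equiv.Perm.one_apply, Equiv.Perm.one_apply, hstep k']; exact hr'
    · obtain ⟨B₀, hB⟩ := exists_cInf_virtual_entry_rel hlm hul.symm hfl.symm hum.symm hfm.symm huf (κ := la) (Or.inl rfl)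
        (A' := c k') (A := c (k' + 1)) (β := b k') hbla hbla hbmu (by rw [← hjla]; exact hstep k') hrk'
        (by rw [hstep k']; exact hr') (hdivk k') (hdivk (k' + 1)) (ho6 k' hk'₀) (ho6 (k' + 1) hk'₀1) hclean
        (hiso (k' + 1)) (he3 (k' + 1) hk'₀1) (hform k' hk'₀) hℓf hU hledger M N
      refine ⟨B₀, ?_⟩
      simpa only [Equiv.Perm.coe_one, id_eq] using hB
  · -- SLOT step in the chart `μ`
    have hbmu : b k' mu = 0 := by rw [← hjmu]; exact hbj k'
    refine ⟨la, mu, u, f, 1, hlm, hul.symm, hfl.symm, hum.symm, hfm.symm, huf, ?_, fun M N => ?_⟩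
    · rw [Equiv.Perm.one_apply, Equiv.Perm.one_apply, hstep k']; exact hr'
    · obtain ⟨B₀, hB⟩ := exists_cInf_virtual_entry_rel hlm hul.symm hfl.symm hum.symm hfm.symm huf (κ := mu) (Or.inr rfl)
        (A' := c k') (A := c (k' + 1)) (β := b k') hbmu hbla hbmu (by rw [← hjmu]; exact hstep k') hrk'
        (by rw [hstep k']; exact hr') (hdivk k') (hdivk (k' + 1)) (ho6 k' hk'₀) (ho6 (k' + 1) hk'₀1) hclean
        (hiso (k' + 1)) (he3 (k' + 1) hk'₀1) (hform k' hk'₀) hℓf hU hledger M N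
      refine ⟨B₀, ?_⟩
      simpa only [Equiv.Perm.coe_one, id_eq] using hB
  · -- ROTATION dropping `λ`
    have hrA : (c (k' + 1)).r = Finsupp.single (j k') 1 + Finsupp.single mu 1 := by rw [hstep k']; exact hr'
    refine ⟨la, mu, u, f, Equiv.swap la (j k'), hlm, hul.symm, hfl.symm, hum.symm, hfm.symm, huf, ?_, fun M N => ?_⟩
    · have hjl : j k' ≠ la := by rcases hjuf with h | h <;> rw [h]; exacts [hul, hfl]
      have hjm : j k' ≠ mu := by rcases hjuf with h | h <;> rw [h]; exacts [hum, hfm]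
      rw [Equiv.swap_apply_left, Equiv.swap_apply_of_ne_of_ne hlm.symm hjm.symm]; exact hrA
    · obtain ⟨Nc, hcert⟩ := IsolationConverse.exists_certificate_of_isIsolated (hiso (k' + 1))
      rcases hjuf with hju | hjf
      · rw [hju] at hrA ⊢
        exact exists_cInf_virtual_entry_of_rotation hlm hul.symm hfl.symm hum.symm hfm.symm huf (κ := la) (κ' := mu)
          (Or.inl ⟨rfl, rfl⟩) (g := u) (gt := f) (Or.inl ⟨rfl, rfl⟩) (A' := c k') (A := c (k' + 1)) (b := b k')
          (by rw [← hju]; exact hbj k') hbla hbmu (by rw [← hju]; exact hstep k') hrk' (hdivk k') (ho6 k' hk'₀) hclean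
          (hiso (k' + 1)) hcert (ho6 (k' + 1) hk'₀1) (he3 (k' + 1) hk'₀1) hrA (hdivk (k' + 1)) (hform k' hk'₀) hℓf hU
          hledger M N
      · rw [hjf] at hrA ⊢
        exact exists_cInf_virtual_entry_of_rotation hlm hul.symm hfl.symm hum.symm hfm.symm huf (κ := la) (κ' := mu)
          (Or.inl ⟨rfl, rfl⟩) (g := f) (gt := u) (Or.inr ⟨rfl, rfl⟩) (A' := c k') (A := c (k' + 1)) (b := b k')
          (by rw [← hjf]; exact hbj k') hbla hbmu (by rw [← hjf]; exact hstep k') hrk' (hdivk k') (ho6 k' hk'₀) hclean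
          (hiso (k' + 1)) hcert (ho6 (k' + 1) hk'₀1) (he3 (k' + 1) hk'₀1) hrA (hdivk (k' + 1)) (hform k' hk'₀) hℓf hU
          hledger M N
  · -- ROTATION dropping `μ`
    have hrA : (c (k' + 1)).r = Finsupp.single (j k') 1 + Finsupp.single la 1 := by rw [hstep k']; exact hr'
    refine ⟨la, mu, u, f, Equiv.swap mu (j k'), hlm, hul.symm, hfl.symm, hum.symm, hfm.symm, huf, ?_, fun M N => ?_⟩
    · have hjl : j k' ≠ la := by rcases hjuf with h | h <;> rw [h]; exacts [hul, hfl]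
      have hjm : j k' ≠ mu := by rcases hjuf with h | h <;> rw [h]; exacts [hum, hfm]
      rw [Equiv.swap_apply_left, Equiv.swap_apply_of_ne_of_ne hlm hjl.symm]; exact hrA.trans (add_comm _ _)
    · obtain ⟨Nc, hcert⟩ := IsolationConverse.exists_certificate_of_isIsolated (hiso (k' + 1))
      rcases hjuf with hju | hjf
      · rw [hju] at hrA ⊢
        exact exists_cInf_virtual_entry_of_rotation hlm hul.symm hfl.symm hum.symm hfm.symm huf (κ := mu) (κ' := la)
          (Or.inr ⟨rfl, rfl⟩) (g := u) (gt := f) (Or.inl ⟨rfl, rfl⟩) (A' := c k') (A := c (k' + 1)) (b := b k')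
          (by rw [← hju]; exact hbj k') hbmu hbla (by rw [← hju]; exact hstep k') hrk' (hdivk k') (ho6 k' hk'₀) hclean
          (hiso (k' + 1)) hcert (ho6 (k' + 1) hk'₀1) (he3 (k' + 1) hk'₀1) hrA (hdivk (k' + 1)) (hform k' hk'₀) hℓf hU
          hledger M N
      · rw [hjf] at hrA ⊢
        exact exists_cInf_virtual_entry_of_rotation hlm hul.symm hfl.symm hum.symm hfm.symm huf (κ := mu) (κ' := la)
          (Or.inr ⟨rfl, rfl⟩) (g := f) (gt := u) (Or.inr ⟨rfl, rfl⟩) (A' := c k') (A := c (k' + 1)) (b := b k')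
          (by rw [← hjf]; exact hbj k') hbmu hbla (by rw [← hjf]; exact hstep k') hrk' (hdivk k') (ho6 k' hk'₀) hclean
          (hiso (k' + 1)) hcert (ho6 (k' + 1) hk'₀1) (he3 (k' + 1) hk'₀1) hrA (hdivk (k' + 1)) (hform k' hk'₀) hℓf hU
          hledger M N

end ResCone

end Summit.ResolutionOfSingularities.ResolutionOfSingularities.Theorems.PIDim4

end
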